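import Literature.Probability.LatticeModels.IsingFieldModel
import Literature.Probability.LatticeModels.MagnetizationTransport
import HarnessLib

/-!
# The Ising model with a site-dependent field: derivatives along a field ray, convexity of the
# free energy, the GKS/GHS bridge and the GHS concavity of the magnetisation

Topic `Probability/LatticeModels`; continues `IsingFieldModel`. For the finite-volume model with a
site-dependent field (Friedli–Velenik 2017, eq. (3.51) with `J ≡ 1`) we consider the one-parameter
families of fields `h(s) = b + s·v` (the tree's affine coupling path `affCpl b v s` of
`MagnetizationTransport`, here for site fields) and prove:

* **Calculus along the ray** (Friedli–Velenik 2017, proof of Lemma 3.31 (1), first display, and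
  §3.2.3 eq. (3.7), `m^#_Λ = ∂ψ^#_Λ/∂h`): `d/ds ⟨f⟩_{h(s)} = β(⟨f V⟩ - ⟨f⟩⟨V⟩)` with
  `V = ∑_{x∈Λ} v_x σ_x` (`hasDerivAt_fieldExpect_ray`; the general-`f` covariance formula is the
  tree's `hasDerivAt_gksExpect_affCpl_cov`, Glimm–Jaffe 1987 Prop. 4.2.1),
  `d/ds log Z_{h(s)} = β⟨V⟩_{h(s)}` (`hasDerivAt_log_fieldZ_ray`),
  and the **convexity of `s ↦ log Z_{h(s)}`** for every real `β` (`convexOn_log_fieldZ_ray`; its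
  second derivative is `β²` times a variance — Friedli–Velenik 2017, Lemma 3.5: "for each type of
  boundary condition, `(β,h) ↦ ψ^#_Λ(β,h)` is convex").
* **The bridge to the spin systems `ν_{Λ;K}` of `GKSInequalities`** (Friedli–Velenik §3.8.1,
  p. 141): `fieldWeight_eq_gksWeight`, with nonnegative couplings for the free and `+` boundary
  conditions when `β ≥ 0` and `h ≥ 0` on `Λ` (`gksCouplingField_nonneg`); hence **the GHS
  inequality** `fieldExpect_ghs` (Griffiths–Hurst–Sherman 1970; Lebowitz 1974) for these systems.
* **GHS concavity along nonnegative rays** (Friedli–Velenik 2017, Remark 3.41: "the GHS inequality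
  can be used to show that the magnetization `h ↦ ⟨σ₀⟩⁺_{β,h}` is concave"): for `bc ∈ {free, +}`,
  `β ≥ 0`, `b, v ≥ 0` on `Λ` and `x ∈ Λ`, `s ↦ ⟨σₓ⟩^{bc}_{Λ;β,b+sv}` is concave on `[0, ∞)`
  (`concaveOn_fieldExpect_spinAt_ray`).

## References

* S. Friedli, Y. Velenik, *Statistical Mechanics of Lattice Systems* (CUP 2017), §3.2.3
  eq. (3.7), Lemma 3.5, Lemma 3.31 (1) (proof, p. 119), Remark 3.41, §3.8.1 (p. 141).
* J. L. Lebowitz, *GHS and other inequalities*, Comm. Math. Phys. 35 (1974) 87–92.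
-/

noncomputable section

open MeasureTheory Finset Set

namespace Literature.Probability.LatticeModels

variable {V : Type*} (G : SimpleGraph V) [DecidableEq V] [G.LocallyFinite]

/-! ### Field rays `affCpl b v s = b + s·v` and the observable `V = ∑ v_x σ_x` -/

omit [G.LocallyFinite] in
/-- The observable conjugate to the ray direction: `V(σ) = ∑_{x ∈ Λ} v_x σ_x` (the general-graph,
weighted version of `spinSum` of `HighDimTrivialityMoments`). [cite: FriedliVelenik2017, Lemma 3.31 (1)] -/
def raySpin (Λ : Finset V) (v : V → ℝ) (σ : SpinConfig V) : ℝ := ∑ x ∈ Λ, v x * spinAt x σ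

omit [DecidableEq V] [G.LocallyFinite] in
/-- `raySpin` is measurable. [cite: FriedliVelenik2017, §6.2] -/
@[fun_prop]
theorem measurable_raySpin (Λ : Finset V) (v : V → ℝ) : Measurable (raySpin Λ v) :=
  Finset.measurable_sum _ fun x _ => (measurable_spinAt x).const_mul (v x)

omit [DecidableEq V] [G.LocallyFinite] in
/-- `raySpin` is nondecreasing when `v ≥ 0` on `Λ`. [cite: FriedliVelenik2017, §3.6.2] -/
theorem raySpin_mono {Λ : Finset V} {v : V → ℝ} (hv : ∀ x ∈ Λ, 0 ≤ v x) : Monotone (raySpin Λ v) :=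
  fun _ _ h => Finset.sum_le_sum fun x hx => mul_le_mul_of_nonneg_left (spinAt_mono x h) (hv x hx)

/-! ### Calculus along a field ray -/

/-- The weights along a ray are exponentials of an affine function of `s`:
`w_{b+sv}(τ) = w_b(τ) · e^{β s V(τ ∨ bc)}`. [cite: FriedliVelenik2017, §3.6.3] -/
theorem fieldWeight_ray (Λ : Finset V) (β : ℝ) (b v : V → ℝ) (bc : BoundaryCondition V)
    (τ : Λ → ℤˣ) (s : ℝ) :
    fieldWeight G Λ β (affCpl b v s) bc τ =
      fieldWeight G Λ β b bc τ * Real.exp (β * raySpin Λ v (glue Λ τ bc) * s) := by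
  rw [fieldWeight_field_tilt G Λ β b (affCpl b v s) bc τ]
  congr 1
  congr 1
  simp only [affCpl, raySpin, add_sub_cancel_left, Finset.mul_sum, Finset.sum_mul]
  refine Finset.sum_congr rfl fun x _ => ?_
  ring

/-- `d/ds w_{b+sv}(τ) = β V(τ ∨ bc) w_{b+sv}(τ)`. [cite: FriedliVelenik2017, Lemma 3.31 (1), proof] -/
theorem hasDerivAt_fieldWeight_ray (Λ : Finset V) (β : ℝ) (b v : V → ℝ) (bc : BoundaryCondition V)
    (τ : Λ → ℤˣ) (s : ℝ) :
    HasDerivAt (fun s => fieldWeight G Λ β (affCpl b v s) bc τ)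
      (β * raySpin Λ v (glue Λ τ bc) * fieldWeight G Λ β (affCpl b v s) bc τ) s := by
  have hfun : (fun s => fieldWeight G Λ β (affCpl b v s) bc τ) =
      fun s => fieldWeight G Λ β b bc τ * Real.exp (β * raySpin Λ v (glue Λ τ bc) * s) :=
    funext fun s => fieldWeight_ray G Λ β b v bc τ s
  rw [hfun]
  have h1 : HasDerivAt (fun s : ℝ => β * raySpin Λ v (glue Λ τ bc) * s)
      (β * raySpin Λ v (glue Λ τ bc)) s := by
    simpa using (hasDerivAt_id s).const_mul (β * raySpin Λ v (glue Λ τ bc))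
  refine ((h1.exp).const_mul (fieldWeight G Λ β b bc τ)).congr_deriv ?_
  rw [fieldWeight_ray G Λ β b v bc τ s]
  ring

/-- **The derivative of Gibbs averages along a field ray** (Friedli–Velenik 2017, proof of
Lemma 3.31 (1), first display, there for `f = σ₀`; the general-`f` covariance formula is the
tree's `hasDerivAt_gksExpect_affCpl_cov`, Glimm–Jaffe 1987 Prop. 4.2.1):
`d/ds ⟨f⟩_{b+sv} = β(⟨f V⟩ - ⟨f⟩⟨V⟩)` with `V = ∑_{x∈Λ} v_x σ_x`.
[cite: FriedliVelenik2017, Lemma 3.31 (1), proof, p. 119] -/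
theorem hasDerivAt_fieldExpect_ray (Λ : Finset V) (β : ℝ) (b v : V → ℝ) (bc : BoundaryCondition V)
    {f : SpinConfig V → ℝ} (hf : Measurable f) (s : ℝ) :
    HasDerivAt (fun s => fieldExpect G Λ β (affCpl b v s) bc f)
      (β * (fieldExpect G Λ β (affCpl b v s) bc (fun σ => f σ * raySpin Λ v σ) -
        fieldExpect G Λ β (affCpl b v s) bc f *
          fieldExpect G Λ β (affCpl b v s) bc (raySpin Λ v))) s := by
  have hM := measurable_raySpin Λ v
  set Mτ : (Λ → ℤˣ) → ℝ := fun τ => raySpin Λ v (glue Λ τ bc) with hMτ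
  have hw : ∀ τ : Λ → ℤˣ, HasDerivAt (fun s => fieldWeight G Λ β (affCpl b v s) bc τ)
      (β * Mτ τ * fieldWeight G Λ β (affCpl b v s) bc τ) s :=
    fun τ => hasDerivAt_fieldWeight_ray G Λ β b v bc τ s
  have hN : HasDerivAt (fun s => ∑ τ : Λ → ℤˣ, fieldWeight G Λ β (affCpl b v s) bc τ * f (glue Λ τ bc))
      (∑ τ : Λ → ℤˣ, β * Mτ τ * fieldWeight G Λ β (affCpl b v s) bc τ * f (glue Λ τ bc)) s :=
    HasDerivAt.fun_sum fun τ _ => (hw τ).mul_const _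
  have hZ : HasDerivAt (fun s => fieldZ G Λ β (affCpl b v s) bc)
      (∑ τ : Λ → ℤˣ, β * Mτ τ * fieldWeight G Λ β (affCpl b v s) bc τ) s := by
    unfold fieldZ
    exact HasDerivAt.fun_sum fun τ _ => hw τ
  have hZpos := fieldZ_pos G Λ β (affCpl b v s) bc
  have hform : (fun s => fieldExpect G Λ β (affCpl b v s) bc f) = fun s =>
      (∑ τ : Λ → ℤˣ, fieldWeight G Λ β (affCpl b v s) bc τ * f (glue Λ τ bc)) /
        fieldZ G Λ β (affCpl b v s) bc := by
    funext s
    exact fieldExpect_eq_sum_div G Λ β _ bc hf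
  rw [hform]
  refine (hN.div hZ hZpos.ne').congr_deriv ?_
  have hfM : Measurable fun σ : SpinConfig V => f σ * raySpin Λ v σ := hf.mul hM
  rw [fieldExpect_eq_sum_div G Λ β _ bc hfM, fieldExpect_eq_sum_div G Λ β _ bc hf,
    fieldExpect_eq_sum_div G Λ β _ bc hM]
  have h1 : ∑ τ : Λ → ℤˣ, β * Mτ τ * fieldWeight G Λ β (affCpl b v s) bc τ * f (glue Λ τ bc) =
      β * ∑ τ : Λ → ℤˣ, fieldWeight G Λ β (affCpl b v s) bc τ * (f (glue Λ τ bc) * Mτ τ) := by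
    rw [Finset.mul_sum]; exact Finset.sum_congr rfl fun τ _ => by ring
  have h2 : ∑ τ : Λ → ℤˣ, β * Mτ τ * fieldWeight G Λ β (affCpl b v s) bc τ =
      β * ∑ τ : Λ → ℤˣ, fieldWeight G Λ β (affCpl b v s) bc τ * Mτ τ := by
    rw [Finset.mul_sum]; exact Finset.sum_congr rfl fun τ _ => by ring
  rw [h1, h2]
  field_simp
  simp only [hMτ]
  ring

/-- **The derivative of the free energy along a field ray**: `d/ds log Z_{b+sv} = β ⟨V⟩_{b+sv}`
(Friedli–Velenik 2017, §3.2.3 eq. (3.7): "as can be easily checked, `m^#_Λ = ∂ψ^#_Λ/∂h`", here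
along a site-dependent ray; the tree's uniform-field twin is
`hasDerivAt_log_isingPartitionFunction_field`). [cite: FriedliVelenik2017, §3.2.3 eq. (3.7)] -/
theorem hasDerivAt_log_fieldZ_ray (Λ : Finset V) (β : ℝ) (b v : V → ℝ) (bc : BoundaryCondition V)
    (s : ℝ) :
    HasDerivAt (fun s => Real.log (fieldZ G Λ β (affCpl b v s) bc))
      (β * fieldExpect G Λ β (affCpl b v s) bc (raySpin Λ v)) s := by
  have hM := measurable_raySpin Λ v
  set Mτ : (Λ → ℤˣ) → ℝ := fun τ => raySpin Λ v (glue Λ τ bc) with hMτ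
  have hZ : HasDerivAt (fun s => fieldZ G Λ β (affCpl b v s) bc)
      (∑ τ : Λ → ℤˣ, β * Mτ τ * fieldWeight G Λ β (affCpl b v s) bc τ) s := by
    unfold fieldZ
    exact HasDerivAt.fun_sum fun τ _ => hasDerivAt_fieldWeight_ray G Λ β b v bc τ s
  have hZpos := fieldZ_pos G Λ β (affCpl b v s) bc
  refine (hZ.log hZpos.ne').congr_deriv ?_
  rw [fieldExpect_eq_sum_div G Λ β _ bc hM, mul_div_assoc']
  congr 1
  rw [Finset.mul_sum]
  exact Finset.sum_congr rfl fun τ _ => by simp only [hMτ]; ring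

/-- The variance of `V` is nonnegative: `⟨V²⟩ - ⟨V⟩² = ⟨(V - ⟨V⟩)²⟩ ≥ 0`. [folklore] -/
theorem fieldExpect_sq_sub_sq_nonneg (Λ : Finset V) (β : ℝ) (h : V → ℝ) (bc : BoundaryCondition V)
    {g : SpinConfig V → ℝ} (hg : Measurable g) :
    0 ≤ fieldExpect G Λ β h bc (fun σ => g σ * g σ) -
      fieldExpect G Λ β h bc g * fieldExpect G Λ β h bc g := by
  set m : ℝ := fieldExpect G Λ β h bc g with hm
  have hsq : Measurable fun σ => (g σ - m) * (g σ - m) := (hg.sub measurable_const).mul (hg.sub measurable_const)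
  have key : fieldExpect G Λ β h bc (fun σ => (g σ - m) * (g σ - m)) =
      fieldExpect G Λ β h bc (fun σ => g σ * g σ) - m * m := by
    have e : (fun σ => (g σ - m) * (g σ - m)) = fun σ => g σ * g σ - (2 * m * g σ - m * m) := by
      funext σ; ring
    rw [e, fieldExpect_sub G Λ β h bc (f := fun σ => g σ * g σ) (g := fun σ => 2 * m * g σ - m * m)
        (hg.mul hg) ((hg.const_mul _).sub measurable_const),
      fieldExpect_sub G Λ β h bc (f := fun σ => 2 * m * g σ) (g := fun _ => m * m) (hg.const_mul _)
        measurable_const,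
      fieldExpect_const_mul G Λ β h bc _ hg, fieldExpect_const_fun]
    ring
  rw [← key]
  exact fieldExpect_nonneg G Λ β h bc hsq fun σ => mul_self_nonneg _

/-- `s ↦ β⟨V⟩_{b+sv}` (the derivative of `log Z` along the ray) is nondecreasing for every real `β`:
its derivative is `β²` times a variance. [cite: FriedliVelenik2017, Lemma 3.5] -/
theorem monotone_beta_mul_fieldExpect_raySpin_ray (Λ : Finset V) (β : ℝ) (b v : V → ℝ)
    (bc : BoundaryCondition V) :
    Monotone fun s => β * fieldExpect G Λ β (affCpl b v s) bc (raySpin Λ v) := by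
  have hM := measurable_raySpin Λ v
  have hderiv := fun s => (hasDerivAt_fieldExpect_ray G Λ β b v bc hM s).const_mul β
  refine monotone_of_deriv_nonneg (fun s => (hderiv s).differentiableAt) fun s => ?_
  rw [(hderiv s).deriv, ← mul_assoc]
  exact mul_nonneg (mul_self_nonneg β) (fieldExpect_sq_sub_sq_nonneg G Λ β _ bc hM)

/-- `s ↦ ⟨V⟩_{b+sv}` is nondecreasing when `β ≥ 0` (Friedli–Velenik 2017, Lemma 3.31 (1): the
magnetisation is nondecreasing in the field). [cite: FriedliVelenik2017, Lemma 3.31 (1)] -/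
theorem monotone_fieldExpect_raySpin_ray {β : ℝ} (hβ : 0 ≤ β) (Λ : Finset V) (b v : V → ℝ)
    (bc : BoundaryCondition V) :
    Monotone fun s => fieldExpect G Λ β (affCpl b v s) bc (raySpin Λ v) := by
  have hM := measurable_raySpin Λ v
  have hderiv := fun s => hasDerivAt_fieldExpect_ray G Λ β b v bc hM s
  refine monotone_of_deriv_nonneg (fun s => (hderiv s).differentiableAt) fun s => ?_
  rw [(hderiv s).deriv]
  exact mul_nonneg hβ (fieldExpect_sq_sub_sq_nonneg G Λ β _ bc hM)

/-- **Convexity of the free energy along a field ray** (Friedli–Velenik 2017, Lemma 3.5: for each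
boundary condition the finite-volume pressure is convex — there for `(β,h)` jointly, by Hölder;
here along the site-dependent ray `b + sv`, for every real `β`, from the monotone derivative
`β⟨V⟩`): `s ↦ log Z^{bc}_{Λ;β,b+sv}` is convex on `ℝ`. [cite: FriedliVelenik2017, Lemma 3.5] -/
theorem convexOn_log_fieldZ_ray (Λ : Finset V) (β : ℝ) (b v : V → ℝ) (bc : BoundaryCondition V) :
    ConvexOn ℝ univ fun s => Real.log (fieldZ G Λ β (affCpl b v s) bc) := by
  have hderiv := fun s => hasDerivAt_log_fieldZ_ray G Λ β b v bc s
  refine MonotoneOn.convexOn_of_deriv convex_univ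
    (fun s _ => (hderiv s).continuousAt.continuousWithinAt)
    (fun s _ => (hderiv s).differentiableAt.differentiableWithinAt) ?_
  intro s _ t _ hst
  rw [(hderiv s).deriv, (hderiv t).deriv]
  exact monotone_beta_mul_fieldExpect_raySpin_ray G Λ β b v bc hst

/-! ### The bridge to `ν_{Λ;K}` and the GHS inequality -/

/-- The couplings of the site-dependent-field model in the form `ν_{Λ;K}` of `GKSInequalities`:
the tree's `gksCoupling` on the edges (`β · edgeCoeff`), `K_{{x}} = β h_x` on the sites.
[cite: FriedliVelenik2017, §3.8.1, p. 141] -/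
def gksCouplingField (Λ : Finset V) (β : ℝ) (h : V → ℝ) (bc : BoundaryCondition V) : Sym2 V ⊕ V → ℝ
  | .inl e => gksCoupling G Λ β 0 bc (.inl e)
  | .inr x => β * h x

/-- For a constant field the couplings are the tree's `gksCoupling`; so `isingExpect_ghs` is the
constant-field case of `fieldExpect_ghs`, and `concaveOn_isingExpect_spinAt` is the `b = 0, v ≡ 1`
case of `concaveOn_fieldExpect_spinAt_ray` (via `fieldExpect_const`, `affCpl 0 1 s = fun _ => s`).
[cite: FriedliVelenik2017, §3.8.1, p. 141] -/
theorem gksCouplingField_const (Λ : Finset V) (β h : ℝ) (bc : BoundaryCondition V) :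
    gksCouplingField G Λ β (fun _ => h) bc = gksCoupling G Λ β h bc := by
  funext i
  rcases i with e | x
  · simp [gksCouplingField, gksCoupling]
  · simp [gksCouplingField, gksCoupling]

/-- **The Gibbs weight in the form `ν_{Λ;K}`**: `-β ℋ^{bc}_{Λ;h}(τ·bc) = ∑ᵢ Kᵢ τ_{Cᵢ}` with the
couplings `gksCouplingField` and the supports `isingSupp` (the edge part is the tree's
`gksHamiltonian_ising` at zero field, the field part is `∑ β hₓ σₓ`).
[cite: FriedliVelenik2017, §3.8.1, p. 141] -/
theorem gksHamiltonian_field (Λ : Finset V) (β : ℝ) (h : V → ℝ) (bc : BoundaryCondition V)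
    (τ : SpinConfig ↥Λ) :
    gksHamiltonian (isingIdx G Λ) (gksCouplingField G Λ β h bc) (isingSupp Λ) τ =
      -β * fieldHamiltonian G Λ h bc (glue Λ τ bc) := by
  have h0 := gksHamiltonian_ising G Λ β 0 bc τ
  rw [gksHamiltonian, isingIdx, Finset.sum_disjSum] at h0 ⊢
  have hE : ∑ e ∈ edgesTouching G Λ, gksCouplingField G Λ β h bc (.inl e) * spinProduct (isingSupp Λ (.inl e)) τ =
      ∑ e ∈ edgesTouching G Λ, gksCoupling G Λ β 0 bc (.inl e) * spinProduct (isingSupp Λ (.inl e)) τ :=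
    Finset.sum_congr rfl fun e _ => rfl
  have hS0 : ∑ x ∈ Λ, gksCoupling G Λ β 0 bc (.inr x) * spinProduct (isingSupp Λ (.inr x)) τ = 0 := by
    refine Finset.sum_eq_zero fun x _ => ?_
    simp [gksCoupling]
  have hS : ∑ x ∈ Λ, gksCouplingField G Λ β h bc (.inr x) * spinProduct (isingSupp Λ (.inr x)) τ =
      β * ∑ x ∈ Λ, h x * spinAt x (glue Λ τ bc) := by
    rw [Finset.mul_sum]
    refine Finset.sum_congr rfl fun x hx => ?_
    simp only [gksCouplingField]
    rw [spinProduct_isingSupp_inr τ bc hx]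
    ring
  rw [hS0, add_zero] at h0
  rw [hE, h0, hS]
  simp only [isingHamiltonian, fieldHamiltonian, zero_mul, sub_zero]
  ring

/-- The Boltzmann weight of the site-dependent-field model is the weight of `ν_{Λ;K}`.
[cite: FriedliVelenik2017, §3.8.1, p. 141] -/
theorem fieldWeight_eq_gksWeight (Λ : Finset V) (β : ℝ) (h : V → ℝ) (bc : BoundaryCondition V)
    (τ : SpinConfig ↥Λ) :
    fieldWeight G Λ β h bc τ =
      gksWeight (isingIdx G Λ) (gksCouplingField G Λ β h bc) (isingSupp Λ) τ := by
  rw [fieldWeight, gksWeight, gksHamiltonian_field]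

/-- `⟨f⟩^{bc}_{Λ;β,h} = (∑_τ f(τ·bc) w(τ)) / ∑_τ w(τ)` in terms of `ν_{Λ;K}`.
[cite: FriedliVelenik2017, §3.8.1, p. 141] -/
theorem fieldExpect_eq_gksSum_div (Λ : Finset V) (β : ℝ) (h : V → ℝ) (bc : BoundaryCondition V)
    {f : SpinConfig V → ℝ} (hf : Measurable f) :
    fieldExpect G Λ β h bc f =
      gksSum (isingIdx G Λ) (gksCouplingField G Λ β h bc) (isingSupp Λ) (fun τ => f (glue Λ τ bc)) /
        gksSum (isingIdx G Λ) (gksCouplingField G Λ β h bc) (isingSupp Λ) (fun _ => 1) := by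
  rw [fieldExpect_eq_sum_div G Λ β h bc hf, gksSum, gksSum, fieldZ]
  congr 1
  · exact Finset.sum_congr rfl fun τ _ => by rw [fieldWeight_eq_gksWeight, mul_comm]
  · exact Finset.sum_congr rfl fun τ _ => by rw [fieldWeight_eq_gksWeight, one_mul]

/-- **Nonnegativity of the couplings** for the free and `+` boundary conditions when `β ≥ 0` and
`h ≥ 0` on `Λ` (Friedli–Velenik 2017, §3.8.1, p. 141: "`K_C ≥ 0` if `h ≥ 0`").
[cite: FriedliVelenik2017, §3.8.1, p. 141] -/
theorem gksCouplingField_nonneg {Λ : Finset V} {β : ℝ} (hβ : 0 ≤ β) {h : V → ℝ}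
    (hh : ∀ x ∈ Λ, 0 ≤ h x) {bc : BoundaryCondition V} (hbc : bc = .free ∨ bc = .plus) :
    ∀ i ∈ isingIdx G Λ, 0 ≤ gksCouplingField G Λ β h bc i := by
  intro i hi
  rcases i with e | x
  · exact gksCoupling_nonneg G hβ le_rfl hbc (.inl e) hi
  · have hx : x ∈ Λ := Finset.inr_mem_disjSum.1 hi
    exact mul_nonneg hβ (hh x hx)

/-- **The GHS inequality for the site-dependent-field model** with free or `+` boundary condition,
`β ≥ 0` and `h ≥ 0` on `Λ` (Griffiths–Hurst–Sherman 1970; Lebowitz 1974, eq. (1.8)): for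
`x, y, z ∈ Λ`, `u₃(x,y,z) ≤ 0`. [cite: Lebowitz1974, eq. (1.8)] -/
theorem fieldExpect_ghs {Λ : Finset V} {β : ℝ} (hβ : 0 ≤ β) {h : V → ℝ} (hh : ∀ x ∈ Λ, 0 ≤ h x)
    {bc : BoundaryCondition V} (hbc : bc = .free ∨ bc = .plus) {x y z : V} (hx : x ∈ Λ)
    (hy : y ∈ Λ) (hz : z ∈ Λ) :
    fieldExpect G Λ β h bc (fun σ => spinAt x σ * spinAt y σ * spinAt z σ) -
        fieldExpect G Λ β h bc (fun σ => spinAt x σ * spinAt y σ) * fieldExpect G Λ β h bc (spinAt z) -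
        fieldExpect G Λ β h bc (fun σ => spinAt x σ * spinAt z σ) * fieldExpect G Λ β h bc (spinAt y) -
        fieldExpect G Λ β h bc (fun σ => spinAt y σ * spinAt z σ) * fieldExpect G Λ β h bc (spinAt x) +
        2 * (fieldExpect G Λ β h bc (spinAt x) * fieldExpect G Λ β h bc (spinAt y) *
          fieldExpect G Λ β h bc (spinAt z)) ≤ 0 := by
  have mx := measurable_spinAt (V := V) x
  have my := measurable_spinAt (V := V) y
  have mz := measurable_spinAt (V := V) z
  have mxyz : Measurable fun σ : SpinConfig V => spinAt x σ * spinAt y σ * spinAt z σ :=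
    (mx.mul my).mul mz
  have mxy : Measurable fun σ : SpinConfig V => spinAt x σ * spinAt y σ := mx.mul my
  have mxz : Measurable fun σ : SpinConfig V => spinAt x σ * spinAt z σ := mx.mul mz
  have myz : Measurable fun σ : SpinConfig V => spinAt y σ * spinAt z σ := my.mul mz
  rw [fieldExpect_eq_gksSum_div G Λ β h bc mxyz,
    fieldExpect_eq_gksSum_div G Λ β h bc mxy, fieldExpect_eq_gksSum_div G Λ β h bc mxz,
    fieldExpect_eq_gksSum_div G Λ β h bc myz, fieldExpect_eq_gksSum_div G Λ β h bc mx,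
    fieldExpect_eq_gksSum_div G Λ β h bc my, fieldExpect_eq_gksSum_div G Λ β h bc mz]
  simp only [spinAt_glue_of_mem _ _ hx, spinAt_glue_of_mem _ _ hy, spinAt_glue_of_mem _ _ hz]
  have key := gksExpect_ghs (isingIdx G Λ) (gksCouplingField G Λ β h bc) (isingSupp Λ)
    (gksCouplingField_nonneg G hβ hh hbc) (fun i _ => card_isingSupp_le_two Λ i) ⟨x, hx⟩ ⟨y, hy⟩ ⟨z, hz⟩
  simpa only [gksExpect] using key

/-! ### GHS concavity of the one-point function along nonnegative field rays -/

/-- The derivative of the one-point function along a ray: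
`d/ds ⟨σₓ⟩_{b+sv} = β ∑_{y ∈ Λ} v_y (⟨σₓσ_y⟩ - ⟨σₓ⟩⟨σ_y⟩)`. [cite: FriedliVelenik2017, Lemma 3.31 (1), proof, p. 119] -/
theorem hasDerivAt_fieldExpect_spinAt_ray (Λ : Finset V) (β : ℝ) (b v : V → ℝ)
    (bc : BoundaryCondition V) (x : V) (s : ℝ) :
    HasDerivAt (fun s => fieldExpect G Λ β (affCpl b v s) bc (spinAt x))
      (β * ∑ y ∈ Λ, v y * (fieldExpect G Λ β (affCpl b v s) bc (fun σ => spinAt x σ * spinAt y σ) -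
        fieldExpect G Λ β (affCpl b v s) bc (spinAt x) *
          fieldExpect G Λ β (affCpl b v s) bc (spinAt y))) s := by
  have mx := measurable_spinAt (V := V) x
  refine (hasDerivAt_fieldExpect_ray G Λ β b v bc mx s).congr_deriv ?_
  set h := affCpl b v s
  have h1 : fieldExpect G Λ β h bc (fun σ => spinAt x σ * raySpin Λ v σ) =
      ∑ y ∈ Λ, v y * fieldExpect G Λ β h bc (fun σ => spinAt x σ * spinAt y σ) := by
    have : (fun σ : SpinConfig V => spinAt x σ * raySpin Λ v σ) =
        fun σ => ∑ y ∈ Λ, v y * (spinAt x σ * spinAt y σ) := by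
      funext σ; simp only [raySpin, Finset.mul_sum]; exact Finset.sum_congr rfl fun y _ => by ring
    rw [this, fieldExpect_finset_sum G Λ β h bc Λ (fun y σ => v y * (spinAt x σ * spinAt y σ))
      (fun y => (mx.mul (measurable_spinAt y)).const_mul _)]
    exact Finset.sum_congr rfl fun y _ =>
      fieldExpect_const_mul G Λ β h bc _ (mx.mul (measurable_spinAt y))
  have h2 : fieldExpect G Λ β h bc (raySpin Λ v) = ∑ y ∈ Λ, v y * fieldExpect G Λ β h bc (spinAt y) := by
    unfold raySpin
    rw [fieldExpect_finset_sum G Λ β h bc Λ (fun y σ => v y * spinAt y σ)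
      (fun y => (measurable_spinAt y).const_mul _)]
    exact Finset.sum_congr rfl fun y _ => fieldExpect_const_mul G Λ β h bc _ (measurable_spinAt y)
  rw [h1, h2, Finset.mul_sum, ← Finset.sum_sub_distrib]
  congr 1
  exact Finset.sum_congr rfl fun y _ => by ring

/-- The derivative of a truncated two-point function along a ray:
`d/ds (⟨σₓσ_y⟩ - ⟨σₓ⟩⟨σ_y⟩)_{b+sv} = β ∑_{z ∈ Λ} v_z u₃(x,y,z)`. [folklore] -/
theorem hasDerivAt_fieldTrunc_ray (Λ : Finset V) (β : ℝ) (b v : V → ℝ) (bc : BoundaryCondition V)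
    (x y : V) (s : ℝ) :
    HasDerivAt (fun s => fieldExpect G Λ β (affCpl b v s) bc (fun σ => spinAt x σ * spinAt y σ) -
        fieldExpect G Λ β (affCpl b v s) bc (spinAt x) *
          fieldExpect G Λ β (affCpl b v s) bc (spinAt y))
      (β * ∑ z ∈ Λ, v z *
        (fieldExpect G Λ β (affCpl b v s) bc (fun σ => spinAt x σ * spinAt y σ * spinAt z σ) -
          fieldExpect G Λ β (affCpl b v s) bc (fun σ => spinAt x σ * spinAt y σ) *
            fieldExpect G Λ β (affCpl b v s) bc (spinAt z) -
          fieldExpect G Λ β (affCpl b v s) bc (fun σ => spinAt x σ * spinAt z σ) *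
            fieldExpect G Λ β (affCpl b v s) bc (spinAt y) -
          fieldExpect G Λ β (affCpl b v s) bc (fun σ => spinAt y σ * spinAt z σ) *
            fieldExpect G Λ β (affCpl b v s) bc (spinAt x) +
          2 * (fieldExpect G Λ β (affCpl b v s) bc (spinAt x) *
            fieldExpect G Λ β (affCpl b v s) bc (spinAt y) *
            fieldExpect G Λ β (affCpl b v s) bc (spinAt z)))) s := by
  have mx := measurable_spinAt (V := V) x
  have my := measurable_spinAt (V := V) y
  have mxy : Measurable fun σ : SpinConfig V => spinAt x σ * spinAt y σ := mx.mul my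
  have hxy := hasDerivAt_fieldExpect_ray G Λ β b v bc mxy s
  have hx := hasDerivAt_fieldExpect_spinAt_ray G Λ β b v bc x s
  have hy := hasDerivAt_fieldExpect_spinAt_ray G Λ β b v bc y s
  refine (hxy.sub (hx.mul hy)).congr_deriv ?_
  set h := affCpl b v s
  have e1 : fieldExpect G Λ β h bc (fun σ => spinAt x σ * spinAt y σ * raySpin Λ v σ) =
      ∑ z ∈ Λ, v z * fieldExpect G Λ β h bc (fun σ => spinAt x σ * spinAt y σ * spinAt z σ) := by
    have : (fun σ : SpinConfig V => spinAt x σ * spinAt y σ * raySpin Λ v σ) =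
        fun σ => ∑ z ∈ Λ, v z * (spinAt x σ * spinAt y σ * spinAt z σ) := by
      funext σ; simp only [raySpin, Finset.mul_sum]; exact Finset.sum_congr rfl fun z _ => by ring
    rw [this, fieldExpect_finset_sum G Λ β h bc Λ (fun z σ => v z * (spinAt x σ * spinAt y σ * spinAt z σ))
      (fun z => (mxy.mul (measurable_spinAt z)).const_mul _)]
    exact Finset.sum_congr rfl fun z _ =>
      fieldExpect_const_mul G Λ β h bc _ (mxy.mul (measurable_spinAt z))
  have e2 : fieldExpect G Λ β h bc (raySpin Λ v) = ∑ z ∈ Λ, v z * fieldExpect G Λ β h bc (spinAt z) := by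
    unfold raySpin
    rw [fieldExpect_finset_sum G Λ β h bc Λ (fun z σ => v z * spinAt z σ)
      (fun z => (measurable_spinAt z).const_mul _)]
    exact Finset.sum_congr rfl fun z _ => fieldExpect_const_mul G Λ β h bc _ (measurable_spinAt z)
  have e3 : ∀ z, fieldExpect G Λ β h bc (fun σ => spinAt y σ * spinAt z σ) =
      fieldExpect G Λ β h bc (fun σ => spinAt z σ * spinAt y σ) := by
    intro z; congr 1; funext σ; ring
  rw [e1, e2]
  simp only [Finset.mul_sum, ← Finset.sum_sub_distrib, Finset.sum_mul, ← Finset.sum_add_distrib]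
  refine Finset.sum_congr rfl fun z _ => ?_
  rw [e3 z]
  ring

/-- **GHS monotonicity of truncated two-point functions along nonnegative rays**: for
`bc ∈ {free, +}`, `β ≥ 0`, `b, v ≥ 0` on `Λ` and `x, y ∈ Λ`, `s ↦ (⟨σₓσ_y⟩ - ⟨σₓ⟩⟨σ_y⟩)_{b+sv}` is
nonincreasing on `[0, ∞)` (its derivative is `β ∑_z v_z u₃(x,y,z) ≤ 0`; Lebowitz 1974,
Remark (ii) after the proof: "for `h ≥ 0`, `⟨q_A⟩` is a decreasing function of the external
fields"). [cite: Lebowitz1974, §2, Remark (ii) following the proof of the Theorem] -/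
theorem antitoneOn_fieldTrunc_ray {Λ : Finset V} {β : ℝ} (hβ : 0 ≤ β) {b v : V → ℝ}
    (hb : ∀ x ∈ Λ, 0 ≤ b x) (hv : ∀ x ∈ Λ, 0 ≤ v x) {bc : BoundaryCondition V}
    (hbc : bc = .free ∨ bc = .plus) {x y : V} (hx : x ∈ Λ) (hy : y ∈ Λ) :
    AntitoneOn (fun s => fieldExpect G Λ β (affCpl b v s) bc (fun σ => spinAt x σ * spinAt y σ) -
        fieldExpect G Λ β (affCpl b v s) bc (spinAt x) *
          fieldExpect G Λ β (affCpl b v s) bc (spinAt y)) (Ici 0) := by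
  have hderiv := fun s => hasDerivAt_fieldTrunc_ray G Λ β b v bc x y s
  refine antitoneOn_of_deriv_nonpos (convex_Ici 0)
    (fun s _ => (hderiv s).continuousAt.continuousWithinAt)
    (fun s _ => (hderiv s).differentiableAt.differentiableWithinAt) ?_
  intro s hs
  rw [interior_Ici] at hs
  rw [(hderiv s).deriv]
  refine mul_nonpos_iff.2 (Or.inl ⟨hβ, Finset.sum_nonpos fun z hz => ?_⟩)
  refine mul_nonpos_iff.2 (Or.inl ⟨hv z hz, ?_⟩)
  have hh : ∀ w ∈ Λ, 0 ≤ affCpl b v s w := fun w hw =>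
    add_nonneg (hb w hw) (mul_nonneg (le_of_lt hs) (hv w hw))
  exact fieldExpect_ghs G hβ hh hbc hx hy hz

/-- **GHS concavity of the finite-volume magnetisation along a nonnegative field ray**
(Griffiths–Hurst–Sherman 1970; Friedli–Velenik 2017, Remark 3.41, p. 126: "the GHS inequality
can be used to show that the magnetization … is concave"; here for a site-dependent field varied
on part of the volume): for `bc ∈ {free, +}`, `β ≥ 0`, `b, v ≥ 0` on `Λ` and `x ∈ Λ`,
`s ↦ ⟨σₓ⟩^{bc}_{Λ;β,b+sv}` is concave on `[0, ∞)`.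
[cite: FriedliVelenik2017, Remark 3.41 (p. 126)] [cite: Lebowitz1974, eq. (1.8)] -/
theorem concaveOn_fieldExpect_spinAt_ray {Λ : Finset V} {β : ℝ} (hβ : 0 ≤ β) {b v : V → ℝ}
    (hb : ∀ x ∈ Λ, 0 ≤ b x) (hv : ∀ x ∈ Λ, 0 ≤ v x) {bc : BoundaryCondition V}
    (hbc : bc = .free ∨ bc = .plus) {x : V} (hx : x ∈ Λ) :
    ConcaveOn ℝ (Ici 0) (fun s => fieldExpect G Λ β (affCpl b v s) bc (spinAt x)) := by
  have hderiv := fun s => hasDerivAt_fieldExpect_spinAt_ray G Λ β b v bc x s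
  refine AntitoneOn.concaveOn_of_deriv (convex_Ici 0)
    (fun s _ => (hderiv s).continuousAt.continuousWithinAt)
    (fun s _ => (hderiv s).differentiableAt.differentiableWithinAt) ?_
  rw [interior_Ici]
  intro a ha c hc hac
  rw [(hderiv a).deriv, (hderiv c).deriv]
  refine mul_le_mul_of_nonneg_left (Finset.sum_le_sum fun y hy => ?_) hβ
  refine mul_le_mul_of_nonneg_left ?_ (hv y hy)
  exact antitoneOn_fieldTrunc_ray G hβ hb hv hbc hx hy (le_of_lt (show (0 : ℝ) < a from ha))
    (le_of_lt (show (0 : ℝ) < c from hc)) hac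

/-- The finite-volume magnetisation along a ray is continuous in `s`. [folklore] -/
theorem continuous_fieldExpect_ray (Λ : Finset V) (β : ℝ) (b v : V → ℝ) (bc : BoundaryCondition V)
    {f : SpinConfig V → ℝ} (hf : Measurable f) :
    Continuous fun s => fieldExpect G Λ β (affCpl b v s) bc f :=
  continuous_iff_continuousAt.2 fun s => (hasDerivAt_fieldExpect_ray G Λ β b v bc hf s).continuousAt

end Literature.Probability.LatticeModels

end
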